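import Literature.Analysis.FluidPDE.AxisymQuotientEquationsOmega
import HarnessLib

/-!
# The equation of `J = ωʳ/r` for axisymmetric Navier–Stokes flows (Lei–Zhang 2017, (1.4)₁),
# as an identity of smooth functions on `ℝ³`

Analysis/FluidPDE proof file (theorems only; no definitions, no named facts), sequel of
`AxisymQuotientEquationsOmega.lean` (the `Ω`-equation), on the discharge path of the named facts
`Literature.Analysis.FluidPDE.LeiZhang2017_logModulus_regularity`,
`…LeiZhang2017_smallSwirl_regularity` and `…Wei2016_logModulus_regularity`:

> "`∂ₜJ + (b·∇)J = (Δ + (2/r)∂ᵣ)J + (ωʳ∂ᵣ + ωᶻ∂_z)(vʳ/r)`", `J = ωʳ/r`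
> (Lei–Zhang 2017, arXiv:1505.02628, (1.4)₁, p. 4; Wei 2016, (1.5); Chen–Fang–Zhang 2017).

With the smooth Hou–Li variables `J = radVelQuot (curl u) = radQuot ⟪x_h, ω⟫` and
`W = radVelQuot u = vʳ/r` (`AxisymHouLiVariables.lean`, smooth across the axis), this file proves
for a classical solution of the unforced system with viscosity `ν` on a time set
`S ⊆ closure (interior S)` of unique differentiability with axisymmetric velocity, at every
`t ∈ S` and EVERY `x`:

* `IsClassicalNSSolutionOn.radVelQuot_curl_eq` —
  `J'(x) + DJ(x)[u] = ν (ΔJ(x) + 2 radDerivQuot J (x)) + DW(x)[ω(x)]`,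
  where `J' = radVelQuot (curl (∂ₜu t))` is the smooth quotient of `⟪x_h, ∂ₜω⟫`
  (`∂ₜω = curl ∂ₜu`, `IsSmoothSpaceTimeOn.timeDerivWithin_vorticity_eq`), and
  `DW[ω] = (ωʳ∂ᵣ + ωᶻ∂_z)(vʳ/r)` since `W` is axisymmetric.

Proof: pair the vorticity equation `∂ₜω + Dω[u] = Du[ω] + νΔω`
(`IsClassicalNSSolutionOn.vorticity_eq`) with the horizontal position vector `x_h = (x₀, x₁, 0)`.
With `Σ = ⟪x_h, ω⟫ = ρJ` and `P = ⟪x_h, u⟫ = ρW` (`ρ = r²`):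
`⟪x_h, Dω[u]⟫ = DΣ[u] − ⟪u_h, ω_h⟫`, `⟪x_h, Du[ω]⟫ = DP[ω] − ⟪ω_h, u_h⟫` (the two correction
terms cancel), `⟪x_h, Δω⟫ = ΔΣ − 2 div_h ω_h` and, `ω` being axisymmetric,
`ρ div_h ω_h = DΣ[x_h]` (`IsAxisymmetric.mul_divH_eq_fderiv_horizontal_inner`, from the
infinitesimal axisymmetry `Dω[Jx] = Jω`). Hence `Σ' + DΣ[u] = ν (ΔΣ − (2/ρ) DΣ[x_h]) + DP[ω]`, and
the template `template_quotient_eq` gives `J' + DJ[u] + 2JW = ν (ΔJ + (2/ρ)DJ[x_h]) + DP[ω]/ρ`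
with `DP[ω]/ρ = 2JW + DW[ω]` — the `JW` terms cancel. Off the axis first, then everywhere by
continuity.

## Mathlib / tree search

Tree: `AxisymQuotientEquations(Omega)` (template, `∂ₜω = curl ∂ₜu`, `ρ`-calculus, axisymmetry of
`∂ₜu`), `IsClassicalNSSolutionOn.vorticity_eq` (`VorticityEquation`), `IsAxisymmetric.fderiv_rotGen`,
`rotGen_eq_sub_single` (`SwirlTransportProofs`), `IsAxisymmetric.curl`, `laplacian_mul_eq`
(`HessianLaplacian`), `fderiv_apply_coord_vec3`, `contDiff_apply_coord_vec3`,
`IsAxisymmetric.cylRadius_sq_mul_radVelQuot` (`AxisymHouLiVariables`), `eq_of_eq_off_ker`.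
Mathlib: `ContDiffAt.laplacian_add`, `ContDiffAt.laplacian_CLM_comp_left`, `fderiv_fun_mul`.
`lean search 'radVelQuot_curl_eq|horizontal_inner_apply'`: nothing before this file.

## References

* Z. Lei, Q. S. Zhang, Pacific J. Math. 289 (2017) 169–187, arXiv:1505.02628, §1 (1.4) (p. 4).
  [`LeiZhang2017`]
* D. Wei, J. Math. Anal. Appl. 435 (2016) 402–413, arXiv:1508.03318, (1.5). [`Wei2016`]
* A. J. Majda, A. L. Bertozzi, *Vorticity and Incompressible Flow*, CUP 2002, §2.3.3.
-/

noncomputable section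

open MeasureTheory Set Function Filter Topology InnerProductSpace WithLp
open scoped RealInnerProductSpace Laplacian ContDiff

namespace Literature.Analysis.FluidPDE

/-! ### Coordinate calculus: `Δ` and `D` of `⟪x_h, w⟫ = x₀w₀ + x₁w₁` -/

section HorizontalInner

variable {w : EuclideanSpace ℝ (Fin 3) → EuclideanSpace ℝ (Fin 3)} {x : EuclideanSpace ℝ (Fin 3)}

/-- `D(y ↦ yᵢ)(x) h = hᵢ`. [folklore] -/
private theorem fderiv_coordFn_apply_vec3 (i : Fin 3) (x h : EuclideanSpace ℝ (Fin 3)) :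
    fderiv ℝ (fun y : EuclideanSpace ℝ (Fin 3) => y i) x h = h i := by
  have : (fun y : EuclideanSpace ℝ (Fin 3) => y i) = ⇑(EuclideanSpace.proj (𝕜 := ℝ) i) := rfl
  rw [this, ContinuousLinearMap.fderiv]
  rfl

/-- `Δ(y ↦ yᵢ) = 0`. [folklore] -/
theorem laplacian_coord_eq_zero (i : Fin 3) (x : EuclideanSpace ℝ (Fin 3)) :
    (Δ (fun y : EuclideanSpace ℝ (Fin 3) => y i)) x = 0 := by
  have hc : ContDiff ℝ 2 (fun y : EuclideanSpace ℝ (Fin 3) => y i) :=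
    (EuclideanSpace.proj (𝕜 := ℝ) i).contDiff
  rw [laplacian_eq_sum_fderiv_fderiv (EuclideanSpace.basisFun (Fin 3) ℝ) hc x]
  refine Finset.sum_eq_zero fun j _ => ?_
  have : (fun y : EuclideanSpace ℝ (Fin 3) => fderiv ℝ (fun y : EuclideanSpace ℝ (Fin 3) => y i) y
      ((EuclideanSpace.basisFun (Fin 3) ℝ) j)) = fun _ => ((EuclideanSpace.basisFun (Fin 3) ℝ) j) i := by
    funext y; exact fderiv_coordFn_apply_vec3 i y _
  rw [this, fderiv_fun_const]
  rfl

/-- Coordinates of the Laplacian of a vector field: `(Δw)ᵢ = Δ(wᵢ)`. [folklore] -/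
theorem laplacian_apply_coord_vec3 (hw : ContDiff ℝ 2 w) (x : EuclideanSpace ℝ (Fin 3)) (i : Fin 3) :
    (Δ w) x i = (Δ (fun y => w y i)) x := by
  have h : (fun y => w y i) = (EuclideanSpace.proj i : (EuclideanSpace ℝ (Fin 3)) →L[ℝ] ℝ) ∘ w := rfl
  rw [h, ContDiffAt.laplacian_CLM_comp_left hw.contDiffAt]
  rfl

/-- **`D⟪x_h, w⟫`**: `D(x₀w₀ + x₁w₁)(x) c = c₀w₀ + c₁w₁ + (x₀ (Dw c)₀ + x₁ (Dw c)₁)`. [folklore] -/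
theorem fderiv_horizontal_inner_apply (hw : DifferentiableAt ℝ w x) (c : EuclideanSpace ℝ (Fin 3)) :
    fderiv ℝ (fun y => y 0 * w y 0 + y 1 * w y 1) x c =
      c 0 * w x 0 + c 1 * w x 1 + (x 0 * fderiv ℝ w x c 0 + x 1 * fderiv ℝ w x c 1) := by
  have hc : ∀ i : Fin 3, DifferentiableAt ℝ (fun y : EuclideanSpace ℝ (Fin 3) => y i) x := fun i =>
    (EuclideanSpace.proj (𝕜 := ℝ) i).differentiableAt
  have hwi : ∀ i : Fin 3, DifferentiableAt ℝ (fun y => w y i) x := fun i =>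
    (EuclideanSpace.proj (𝕜 := ℝ) i).differentiableAt.comp x hw
  rw [fderiv_fun_add ((hc 0).fun_mul (hwi 0)) ((hc 1).fun_mul (hwi 1)), fderiv_fun_mul (hc 0) (hwi 0),
    fderiv_fun_mul (hc 1) (hwi 1)]
  simp only [_root_.add_apply, _root_.FunLike.coe_smul, Pi.smul_apply, smul_eq_mul,
    fderiv_coordFn_apply_vec3, fderiv_apply_coord_vec3 hw]
  ring

/-- `Δ(xᵢ wᵢ) = xᵢ (Δw)ᵢ + 2 ∂ᵢwᵢ`. [folklore] -/
theorem laplacian_coord_mul_apply (hw : ContDiff ℝ 2 w) (i : Fin 3) (x : EuclideanSpace ℝ (Fin 3)) :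
    (Δ (fun y : EuclideanSpace ℝ (Fin 3) => y i * w y i)) x =
      x i * (Δ w) x i + 2 * fderiv ℝ w x (EuclideanSpace.single i 1) i := by
  have hc : ContDiff ℝ 2 (fun y : EuclideanSpace ℝ (Fin 3) => y i) :=
    (EuclideanSpace.proj (𝕜 := ℝ) i).contDiff
  have hwi : ContDiff ℝ 2 (fun y => w y i) := contDiff_apply_coord_vec3 hw i
  have hwd : Differentiable ℝ w := hw.differentiable two_ne_zero
  rw [laplacian_mul_eq (EuclideanSpace.basisFun (Fin 3) ℝ) hc hwi x, laplacian_coord_eq_zero,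
    ← laplacian_apply_coord_vec3 hw x i]
  simp only [EuclideanSpace.basisFun_apply, Fin.sum_univ_three, fderiv_coordFn_apply_vec3,
    fderiv_apply_coord_vec3 (hwd x), mul_zero, add_zero]
  fin_cases i <;> simp

/-- **`Δ⟪x_h, w⟫ = ⟪x_h, Δw⟫ + 2 div_h w_h`**:
`Δ(x₀w₀ + x₁w₁) = x₀(Δw)₀ + x₁(Δw)₁ + 2(∂₀w₀ + ∂₁w₁)`. [folklore] -/
theorem laplacian_horizontal_inner (hw : ContDiff ℝ 2 w) (x : EuclideanSpace ℝ (Fin 3)) :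
    (Δ (fun y : EuclideanSpace ℝ (Fin 3) => y 0 * w y 0 + y 1 * w y 1)) x =
      x 0 * (Δ w) x 0 + x 1 * (Δ w) x 1 +
        2 * (fderiv ℝ w x (EuclideanSpace.single 0 1) 0 + fderiv ℝ w x (EuclideanSpace.single 1 1) 1) := by
  have hprod : ∀ i : Fin 3, ContDiff ℝ 2 (fun y : EuclideanSpace ℝ (Fin 3) => y i * w y i) := fun i =>
    (EuclideanSpace.proj (𝕜 := ℝ) i).contDiff.mul (contDiff_apply_coord_vec3 hw i)
  have hsum : (fun y : EuclideanSpace ℝ (Fin 3) => y 0 * w y 0 + y 1 * w y 1) =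
      (fun y : EuclideanSpace ℝ (Fin 3) => y 0 * w y 0) + fun y : EuclideanSpace ℝ (Fin 3) => y 1 * w y 1 := rfl
  rw [hsum, ContDiffAt.laplacian_add (hprod 0).contDiffAt (hprod 1).contDiffAt,
    laplacian_coord_mul_apply hw 0 x, laplacian_coord_mul_apply hw 1 x]
  ring

/-- **The horizontal divergence of an axisymmetric field**: `ρ (∂₀w₀ + ∂₁w₁) = D⟪x_h, w⟫[x_h]`
(`ρ = x₀² + x₁²`). In cylindrical terms `div_h w_h = (1/r)∂ᵣ(r wʳ)` since `∂_θ w^θ = 0`; the proof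
is the infinitesimal axisymmetry `Dw(x)[Jx] = J w(x)` (`IsAxisymmetric.fderiv_rotGen`). [folklore] -/
theorem IsAxisymmetric.mul_divH_eq_fderiv_horizontal_inner (hax : IsAxisymmetric w)
    (hd : DifferentiableAt ℝ w x) :
    (x 0 ^ 2 + x 1 ^ 2) * (fderiv ℝ w x (EuclideanSpace.single 0 1) 0 +
        fderiv ℝ w x (EuclideanSpace.single 1 1) 1) =
      fderiv ℝ (fun y => y 0 * w y 0 + y 1 * w y 1) x
        ((x 0) • EuclideanSpace.single 0 1 + (x 1) • EuclideanSpace.single 1 1) := by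
  have hJ := hax.fderiv_rotGen hd
  rw [rotGen_eq_sub_single, map_sub, map_smul, map_smul] at hJ
  have hA := congrArg (fun v : EuclideanSpace ℝ (Fin 3) => v 0) hJ
  have hB := congrArg (fun v : EuclideanSpace ℝ (Fin 3) => v 1) hJ
  simp only [PiLp.sub_apply, PiLp.smul_apply, smul_eq_mul, rotGen_apply_zero,
    rotGen_apply_one] at hA hB
  rw [fderiv_horizontal_inner_apply hd, map_add, map_smul, map_smul]
  simp only [PiLp.add_apply, PiLp.smul_apply, smul_eq_mul, PiLp.single_apply]
  simp only [Fin.isValue, ↓reduceIte, one_ne_zero, zero_ne_one, mul_one, mul_zero,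
    add_zero, zero_add]
  linear_combination (-(x 1)) * hA + (x 0) * hB

end HorizontalInner

/-! ### The `J`-equation -/

section JEquation

variable {S : Set ℝ} {ν : ℝ} {v : ℝ → EuclideanSpace ℝ (Fin 3) → EuclideanSpace ℝ (Fin 3)}
  {q : ℝ → EuclideanSpace ℝ (Fin 3) → ℝ}

/-- **The `J`-equation off the axis** (Lei–Zhang 2017, (1.4)₁). [cite: LeiZhang2017, §1 (1.4) (arXiv p. 4)] -/
theorem IsClassicalNSSolutionOn.radVelQuot_curl_eq_of_ne (hns : IsClassicalNSSolutionOn S ν 0 v q)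
    (hS : UniqueDiffOn ℝ S) (hcl : S ⊆ closure (interior S))
    (hax : ∀ s ∈ S, IsAxisymmetric (v s)) {t : ℝ} (ht : t ∈ S)
    {x : EuclideanSpace ℝ (Fin 3)} (hx : cylRadius x ≠ 0) :
    radVelQuot (curl (timeDerivWithin S v t)) x + fderiv ℝ (radVelQuot (curl (v t))) x (v t x) =
      ν * ((Δ (radVelQuot (curl (v t)))) x + 2 * radDerivQuot (radVelQuot (curl (v t))) x) +
        fderiv ℝ (radVelQuot (v t)) x (curl (v t) x) := by
  -- regularity
  have hsm : IsSmoothSpaceTimeOn S v := hns.smooth_velocity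
  have hv : ContDiff ℝ ∞ (v t) := hns.contDiff_velocity ht
  have hv2 : ContDiff ℝ 2 (v t) := hv.of_le (by norm_cast)
  have hv3 : ContDiff ℝ 3 (v t) := hv.of_le (by norm_cast)
  have hvd : Differentiable ℝ (v t) := hv.differentiable (by simp)
  have hdv : ContDiff ℝ ∞ (timeDerivWithin S v t) := hsm.contDiff_timeDerivWithin_slice hS ht
  have hdvd : Differentiable ℝ (timeDerivWithin S v t) := hdv.differentiable (by simp)
  have haxt : IsAxisymmetric (v t) := hax t ht
  have haxdv : IsAxisymmetric (timeDerivWithin S v t) := hsm.isAxisymmetric_timeDerivWithin hax ht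
  have hω : ContDiff ℝ ∞ (curl (v t)) := by
    rw [curl_eq_curlCLM_comp]
    exact curlCLM.contDiff.comp (hv.fderiv_right (m := ∞) (by simp))
  have hω2 : ContDiff ℝ 2 (curl (v t)) := hω.of_le (by norm_cast)
  have hω4 : ContDiff ℝ 4 (curl (v t)) := hω.of_le (by norm_cast)
  have hωd : Differentiable ℝ (curl (v t)) := hω.differentiable (by simp)
  have haxω : IsAxisymmetric (curl (v t)) := haxt.curl hvd
  have hdω : ContDiff ℝ ∞ (curl (timeDerivWithin S v t)) := by
    rw [curl_eq_curlCLM_comp]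
    exact curlCLM.contDiff.comp (hdv.fderiv_right (m := ∞) (by simp))
  have hdω2 : ContDiff ℝ 2 (curl (timeDerivWithin S v t)) := hdω.of_le (by norm_cast)
  have haxdω : IsAxisymmetric (curl (timeDerivWithin S v t)) := haxdv.curl hdvd
  have hJ : ContDiff ℝ 2 (radVelQuot (curl (v t))) := contDiff_radVelQuot (n := 2) hω4
  have hJax : IsAxisymmetricScalar (radVelQuot (curl (v t))) := haxω.isAxisymmetricScalar_radVelQuot hω2
  have hW : ContDiff ℝ 1 (radVelQuot (v t)) := contDiff_radVelQuot (n := 1) hv3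
  have hWd : Differentiable ℝ (radVelQuot (v t)) := hW.differentiable one_ne_zero
  have hρd : Differentiable ℝ (fun y : EuclideanSpace ℝ (Fin 3) => y 0 ^ 2 + y 1 ^ 2) :=
    contDiff_horizSq.differentiable two_ne_zero
  have hρx : x 0 ^ 2 + x 1 ^ 2 ≠ 0 := by
    rwa [sq_add_sq_eq_cylRadius_sq, pow_ne_zero_iff two_ne_zero]
  -- the vorticity equation, paired with `x_h`
  have hveq := hns.vorticity_eq hS hcl (fun _ _ y => curl_zero y) ht x
  have hvort : vorticity v t = curl (v t) := rfl
  rw [hvort, convect_apply, convect_apply, hsm.timeDerivWithin_vorticity_eq hS hcl ht] at hveq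
  have hφ := congrArg (fun V : EuclideanSpace ℝ (Fin 3) => x 0 * V 0 + x 1 * V 1) hveq
  simp only [PiLp.add_apply, PiLp.smul_apply, smul_eq_mul] at hφ
  -- (i) the time derivative: `⟪x_h, curl ∂ₜu⟫ = ρ J'`
  have ht1 : x 0 * curl (timeDerivWithin S v t) x 0 + x 1 * curl (timeDerivWithin S v t) x 1 =
      (x 0 ^ 2 + x 1 ^ 2) * radVelQuot (curl (timeDerivWithin S v t)) x := by
    rw [sq_add_sq_eq_cylRadius_sq, haxdω.cylRadius_sq_mul_radVelQuot hdω2 x]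
  -- (ii) transport: `⟪x_h, Dω[u]⟫ = DΣ[u] − ⟪u_h, ω_h⟫`
  have htr := fderiv_horizontal_inner_apply (hωd x) (v t x)
  -- (iii) stretching: `⟪x_h, Du[ω]⟫ = DP[ω] − ⟪ω_h, u_h⟫`
  have hst := fderiv_horizontal_inner_apply (hvd x) (curl (v t) x)
  -- (iv) viscosity: `⟪x_h, Δω⟫ = ΔΣ − (2/ρ) DΣ[x_h]`
  have hlap := laplacian_horizontal_inner hω2 x
  have hdivH := haxω.mul_divH_eq_fderiv_horizontal_inner (hωd x)
  have hvisc : x 0 * (Δ (curl (v t))) x 0 + x 1 * (Δ (curl (v t))) x 1 =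
      (Δ (fun y : EuclideanSpace ℝ (Fin 3) => y 0 * curl (v t) y 0 + y 1 * curl (v t) y 1)) x -
        2 / (x 0 ^ 2 + x 1 ^ 2) *
          fderiv ℝ (fun y => y 0 * curl (v t) y 0 + y 1 * curl (v t) y 1) x
            ((x 0) • EuclideanSpace.single 0 1 + (x 1) • EuclideanSpace.single 1 1) := by
    rw [hlap, ← hdivH]
    field_simp
    ring
  -- the equation of `Σ = ⟪x_h, ω⟫`: `ρJ' + DΣ[u] = ν (ΔΣ − (2/ρ) DΣ[x_h]) + DP[ω]`
  have hpde : (x 0 ^ 2 + x 1 ^ 2) * radVelQuot (curl (timeDerivWithin S v t)) x +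
      fderiv ℝ (fun y => y 0 * curl (v t) y 0 + y 1 * curl (v t) y 1) x (v t x) =
      ν * ((Δ (fun y : EuclideanSpace ℝ (Fin 3) => y 0 * curl (v t) y 0 + y 1 * curl (v t) y 1)) x -
        2 / (x 0 ^ 2 + x 1 ^ 2) *
          fderiv ℝ (fun y => y 0 * curl (v t) y 0 + y 1 * curl (v t) y 1) x
            ((x 0) • EuclideanSpace.single 0 1 + (x 1) • EuclideanSpace.single 1 1)) +
        fderiv ℝ (fun y => y 0 * v t y 0 + y 1 * v t y 1) x (curl (v t) x) := by
    rw [← ht1, htr, ← hvisc, hst]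
    linear_combination hφ
  -- `Σ = ρ J`, `P = ρ W` as functions
  have hSig : (fun y : EuclideanSpace ℝ (Fin 3) => y 0 * curl (v t) y 0 + y 1 * curl (v t) y 1) =
      fun y => (y 0 ^ 2 + y 1 ^ 2) * radVelQuot (curl (v t)) y := by
    funext y
    rw [sq_add_sq_eq_cylRadius_sq, haxω.cylRadius_sq_mul_radVelQuot hω2 y]
  have hP : (fun y : EuclideanSpace ℝ (Fin 3) => y 0 * v t y 0 + y 1 * v t y 1) =
      fun y => (y 0 ^ 2 + y 1 ^ 2) * radVelQuot (v t) y := by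
    funext y
    rw [sq_add_sq_eq_cylRadius_sq, haxt.cylRadius_sq_mul_radVelQuot hv2 y]
  rw [hSig, hP] at hpde
  -- the template, with `R = DP[ω]`
  have key := template_quotient_eq hJ hρx (ν := ν)
    (R := fderiv ℝ (fun y : EuclideanSpace ℝ (Fin 3) => (y 0 ^ 2 + y 1 ^ 2) * radVelQuot (v t) y) x
      (curl (v t) x)) (c := v t x)
    (σ' := radVelQuot (curl (timeDerivWithin S v t)) x) (by linarith [hpde])
  -- `DP[ω] = 2 ⟪x_h, ω⟫ W + ρ DW[ω] = ρ (2 J W + DW[ω])`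
  have hR : fderiv ℝ (fun y : EuclideanSpace ℝ (Fin 3) => (y 0 ^ 2 + y 1 ^ 2) * radVelQuot (v t) y) x
      (curl (v t) x) = (x 0 ^ 2 + x 1 ^ 2) * (2 * radVelQuot (curl (v t)) x * radVelQuot (v t) x +
        fderiv ℝ (radVelQuot (v t)) x (curl (v t) x)) := by
    rw [fderiv_fun_mul (hρd x) (hWd x)]
    simp only [_root_.add_apply, _root_.FunLike.coe_smul, Pi.smul_apply, smul_eq_mul,
      fderiv_rho_apply]
    have e : x 0 * curl (v t) x 0 + x 1 * curl (v t) x 1 =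
        (x 0 ^ 2 + x 1 ^ 2) * radVelQuot (curl (v t)) x := by
      rw [sq_add_sq_eq_cylRadius_sq, haxω.cylRadius_sq_mul_radVelQuot hω2 x]
    rw [e]
    ring
  rw [fderiv_apply_horizontal_eq hJ hJax, ← sq_add_sq_eq_cylRadius_sq,
    ← haxt.cylRadius_sq_mul_radVelQuot hv2 x, ← sq_add_sq_eq_cylRadius_sq, hR] at key
  have e1 : 2 * radVelQuot (curl (v t)) x * ((x 0 ^ 2 + x 1 ^ 2) * radVelQuot (v t) x) /
      (x 0 ^ 2 + x 1 ^ 2) = 2 * radVelQuot (curl (v t)) x * radVelQuot (v t) x := by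
    field_simp
  have e2 : 2 / (x 0 ^ 2 + x 1 ^ 2) * ((x 0 ^ 2 + x 1 ^ 2) * radDerivQuot (radVelQuot (curl (v t))) x) =
      2 * radDerivQuot (radVelQuot (curl (v t))) x := by
    field_simp
  have e3 : (x 0 ^ 2 + x 1 ^ 2) * (2 * radVelQuot (curl (v t)) x * radVelQuot (v t) x +
      fderiv ℝ (radVelQuot (v t)) x (curl (v t) x)) / (x 0 ^ 2 + x 1 ^ 2) =
      2 * radVelQuot (curl (v t)) x * radVelQuot (v t) x +
        fderiv ℝ (radVelQuot (v t)) x (curl (v t) x) := by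
    field_simp
  rw [e1, e2, e3] at key
  linarith

/-- **The `J`-equation on all of `ℝ³`** (Lei–Zhang 2017, (1.4)₁: `∂ₜJ + (b·∇)J = (Δ + (2/r)∂ᵣ)J +
(ωʳ∂ᵣ + ωᶻ∂_z)(vʳ/r)`, `J = ωʳ/r`): for a classical solution of the unforced system with viscosity
`ν` on a time set `S ⊆ closure (interior S)` of unique differentiability with axisymmetric
velocity, at every `t ∈ S` and EVERY `x`,
`J'(x) + DJ(x)[u] = ν (ΔJ(x) + 2 radDerivQuot J (x)) + DW(x)[ω(x)]` with
`J = radVelQuot (curl (u t))`, `J' = radVelQuot (curl (∂ₜu t))`, `W = radVelQuot (u t)`,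
`ω = curl (u t)` (and `DW[ω] = ωʳ∂ᵣW + ωᶻ∂_zW`, `W` being axisymmetric).
[cite: LeiZhang2017, §1 (1.4) (arXiv p. 4)] -/
theorem IsClassicalNSSolutionOn.radVelQuot_curl_eq (hns : IsClassicalNSSolutionOn S ν 0 v q)
    (hS : UniqueDiffOn ℝ S) (hcl : S ⊆ closure (interior S))
    (hax : ∀ s ∈ S, IsAxisymmetric (v s)) {t : ℝ} (ht : t ∈ S) (x : EuclideanSpace ℝ (Fin 3)) :
    radVelQuot (curl (timeDerivWithin S v t)) x + fderiv ℝ (radVelQuot (curl (v t))) x (v t x) =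
      ν * ((Δ (radVelQuot (curl (v t)))) x + 2 * radDerivQuot (radVelQuot (curl (v t))) x) +
        fderiv ℝ (radVelQuot (v t)) x (curl (v t) x) := by
  have hsm : IsSmoothSpaceTimeOn S v := hns.smooth_velocity
  have hv : ContDiff ℝ ∞ (v t) := hns.contDiff_velocity ht
  have hv3 : ContDiff ℝ 3 (v t) := hv.of_le (by norm_cast)
  have hdv : ContDiff ℝ ∞ (timeDerivWithin S v t) := hsm.contDiff_timeDerivWithin_slice hS ht
  have hω : ContDiff ℝ ∞ (curl (v t)) := by
    rw [curl_eq_curlCLM_comp]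
    exact curlCLM.contDiff.comp (hv.fderiv_right (m := ∞) (by simp))
  have hω4 : ContDiff ℝ 4 (curl (v t)) := hω.of_le (by norm_cast)
  have hdω : ContDiff ℝ ∞ (curl (timeDerivWithin S v t)) := by
    rw [curl_eq_curlCLM_comp]
    exact curlCLM.contDiff.comp (hdv.fderiv_right (m := ∞) (by simp))
  have hdω4 : ContDiff ℝ 4 (curl (timeDerivWithin S v t)) := hdω.of_le (by norm_cast)
  have hJ2 : ContDiff ℝ 2 (radVelQuot (curl (v t))) := contDiff_radVelQuot (n := 2) hω4
  have hJ' : ContDiff ℝ 2 (radVelQuot (curl (timeDerivWithin S v t))) :=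
    contDiff_radVelQuot (n := 2) hdω4
  have hW : ContDiff ℝ 1 (radVelQuot (v t)) := contDiff_radVelQuot (n := 1) hv3
  have hL : Continuous fun y => radVelQuot (curl (timeDerivWithin S v t)) y +
      fderiv ℝ (radVelQuot (curl (v t))) y (v t y) :=
    hJ'.continuous.add ((hJ2.continuous_fderiv two_ne_zero).clm_apply hv.continuous)
  have hR : Continuous fun y => ν * ((Δ (radVelQuot (curl (v t)))) y +
      2 * radDerivQuot (radVelQuot (curl (v t))) y) +
        fderiv ℝ (radVelQuot (v t)) y (curl (v t) y) := by
    refine (continuous_const.mul ((continuous_laplacian hJ2).add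
      (continuous_const.mul (continuous_radDerivQuot hJ2)))).add ?_
    exact (hW.continuous_fderiv one_ne_zero).clm_apply hω.continuous
  refine eq_of_eq_off_ker (EuclideanSpace.proj (0 : Fin 3)) ⟨EuclideanSpace.single 0 1, by simp⟩
    hL hR (fun z hz => ?_) x
  have hz0 : z 0 ≠ 0 := by simpa using hz
  have hzr : cylRadius z ≠ 0 := fun h => hz0 ((cylRadius_eq_zero_iff z).1 h).1
  exact hns.radVelQuot_curl_eq_of_ne hS hcl hax ht hzr

end JEquation

end Literature.Analysis.FluidPDE
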